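import Literature.Barriers.CriticalPhenomena.KozmaNachmiasCor32
import Literature.Barriers.CriticalPhenomena.KozmaNachmiasRegularity
import Literature.Probability.Percolation.SequentialProbingChernoff
import HarnessLib

/-!
# Kozma–Nachmias 2011, §4.4: exploring the cluster of the origin in `Q_j` box by box
# (the exploration process, its martingale estimates Lemmas 4.5–4.6 in Chernoff form)

Barrier catalogue `Literature/Barriers/CriticalPhenomena/` (D-0021), programme for the named fact
`KozmaNachmias2011_thm4` (`KozmaNachmiasRegularity.lean`). §4.4 of the source proves Theorem 5 by an
exploration of `C(0; Q_j)` "in boxes of size `s^{4d²}`": the boxes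
`q_v = (v + Q_{2S}) ∩ Q_j`, `v ∈ (4S+1)ℤ^d + w` (a partition of `Q_j` for each shift `w`), the
boxes not meeting `∂Q_j` being revealed first and then, one at a time, the unexplored box reached
by the cluster of the origin through the explored region; along it two martingales control the
number of explored boxes carrying a boundary vertex joined to `0` (`γ_i`, Lemma 4.5, via
Corollary 3.2) and the number of bad boxes (`β_i`, Lemma 4.6, by locality and Lemma 4.3). This file
builds that exploration as an `Explorer` of `SequentialProbing.lean` and PROVES:

* the grid geometry (`IsGridPt`, `gridOf`, `qbox`, uniqueness `eq_of_mem_qbox_of_mem_qbox`, the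
  boundary boxes `IsBoundaryPt` = the hypothesis of Corollary 3.2);
* the explorer `knExplorer d j S w` (first probe: all pairs of `Q_j` touching the boxes not meeting
  `∂Q_j`; then, while some unexplored boundary box `q_v` contains a vertex `z` joined by a revealed
  open pair to the revealed cluster of `0`, the pairs of `Q_j` touching `q_v` not yet revealed),
  its freshness `knExplorer_fresh`, and the bookkeeping of genuine histories (`explored`,
  `openObs`, `known`; `openObs_hist`, `supp_hist`, …);
* **completeness** `mem_explored_of_openConnIn`: when the exploration has stopped, every vertex of
  `Q_j` joined to `0` inside `Q_j` lies in the explored region; and the exploration has stopped by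
  time `#gridPts + 2` (`next_hist_eq_none`);
* the two designated-probe predicates read off the observation — a *boundary hit* (the entry
  vertex is joined to `∂Q_j` inside the new box; then the box carries a vertex of `∂Q_j` joined to
  `0` in `Q_j`, `boundaryConnCount_ge_nfail`) and a *bad box* (an abstract family `Bad v` of events
  determined by the pairs of `q_v`) — with their conditional probability bounds for EVERY history
  (`le_real_hit`, from Corollary 3.2; `real_bad_le`), whence, by `SequentialProbingChernoff.lean`,
  **Lemma 4.5** `real_few_hits_le` and **Lemma 4.6** `real_many_bad_le` in Chernoff form.

## References

* G. Kozma, A. Nachmias, *Arm exponents in high dimensional percolation*, J. Amer. Math. Soc. 24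
  (2011) 375–409, §4.4 (pp. 393–398): the exploration process, Lemmas 4.5, 4.6.
* G. Grimmett, *Percolation*, 2nd ed., Springer 1999, §7.2–7.4 (dynamic explorations).
-/

noncomputable section

namespace Literature.Barriers.CriticalPhenomena

open _root_.MeasureTheory Finset Literature.Probability.LatticeModels Literature.Probability.Percolation
  Literature.Probability.Percolation.DCT16 ProbeHistory
open scoped Literature.Probability.LatticeModels Literature.Probability.Percolation Classical

variable {d : ℕ}

/-! ### The grid of boxes `q_v = (v + Q_{2S}) ∩ Q_j`, `v ∈ (4S+1)ℤ^d + w` -/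

section Grid

/-- `v` is a point of the shifted grid `(4S+1)ℤ^d + w`. [cite: KozmaNachmias2011, §4.4 (definition of G(w))] -/
def IsGridPt (S : ℕ) (w v : Site d) : Prop := ∀ i, (4 * S + 1 : ℤ) ∣ (v i - w i)

/-- The grid point whose cube `v + Q_{2S}` contains `u`. [folklore] -/
def gridOf (S : ℕ) (w u : Site d) : Site d := fun i =>
  w i + (4 * S + 1 : ℤ) * ((u i - w i + 2 * S) / (4 * S + 1 : ℤ))

/-- `gridOf` is a grid point. [folklore] -/
theorem isGridPt_gridOf (S : ℕ) (w u : Site d) : IsGridPt S w (gridOf S w u) := fun i =>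
  ⟨(u i - w i + 2 * S) / (4 * S + 1 : ℤ), by simp [gridOf]⟩

/-- `u ∈ gridOf u + Q_{2S}`. [folklore] -/
theorem sub_gridOf_mem_box (S : ℕ) (w u : Site d) : u - gridOf S w u ∈ box d (2 * S) := by
  rw [mem_box]
  intro i
  simp only [Pi.sub_apply, gridOf]
  have hpos : (0 : ℤ) < 4 * S + 1 := by positivity
  have h1 := Int.emod_nonneg (u i - w i + 2 * S) hpos.ne'
  have h2 := Int.emod_lt_of_pos (u i - w i + 2 * S) hpos
  have h3 := Int.mul_ediv_add_emod (u i - w i + 2 * S) (4 * S + 1)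
  constructor <;> push_cast <;> linarith

/-- **Uniqueness**: two grid points whose cubes `· + Q_{2S}` share a vertex coincide (the cubes
`v + Q_{2S}`, `v ∈ (4S+1)ℤ^d + w`, tile `ℤ^d`). [cite: KozmaNachmias2011, §4.4 (the boxes of G(w))] -/
theorem eq_of_isGridPt_of_sub_mem_box {S : ℕ} {w v v' u : Site d} (hv : IsGridPt S w v) (hv' : IsGridPt S w v')
    (hu : u - v ∈ box d (2 * S)) (hu' : u - v' ∈ box d (2 * S)) : v = v' := by
  funext i
  obtain ⟨k, hk⟩ := hv i
  obtain ⟨k', hk'⟩ := hv' i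
  obtain ⟨h1a, h1b⟩ := (mem_box.1 hu) i
  obtain ⟨h2a, h2b⟩ := (mem_box.1 hu') i
  simp only [Pi.sub_apply] at h1a h1b h2a h2b
  push_cast at h1a h1b h2a h2b
  have hdvd : (4 * S + 1 : ℤ) ∣ (v i - v' i) := ⟨k - k', by linarith [hk, hk']⟩
  have habs : |v i - v' i| < 4 * S + 1 := by rw [abs_lt]; constructor <;> linarith
  linarith [Int.eq_zero_of_abs_lt_dvd hdvd habs]

/-- **The box `q_v = (v + Q_{2S}) ∩ Q_j`** of the exploration (Kozma–Nachmias 2011, §4.4: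
"`G := {(Q_{2s^{4d²}} + v) ∩ Q_j : v ∈ (4s^{4d²}+1)ℤ^d + w} ∖ {∅}`", here with a general
half-width `2S`). [cite: KozmaNachmias2011, §4.4 (definition of G(w), p. 393)] -/
def qbox (j S : ℕ) (v : Site d) : Finset (Site d) := (box d j).filter fun u => u - v ∈ box d (2 * S)

/-- Membership in `q_v`. [folklore] -/
theorem mem_qbox {j S : ℕ} {v u : Site d} : u ∈ qbox j S v ↔ u ∈ box d j ∧ u - v ∈ box d (2 * S) :=
  Finset.mem_filter

/-- `q_v ⊆ Q_j`. [folklore] -/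
theorem qbox_subset_box (j S : ℕ) (v : Site d) : qbox j S v ⊆ box d j := Finset.filter_subset _ _

/-- Every `u ∈ Q_j` lies in the box of `gridOf u`. [folklore] -/
theorem mem_qbox_gridOf {j : ℕ} (S : ℕ) (w : Site d) {u : Site d} (hu : u ∈ box d j) :
    u ∈ qbox j S (gridOf S w u) :=
  mem_qbox.2 ⟨hu, sub_gridOf_mem_box S w u⟩

/-- Boxes of distinct grid points are disjoint. [folklore] -/
theorem eq_of_mem_qbox_of_mem_qbox {j S : ℕ} {w v v' u : Site d} (hv : IsGridPt S w v) (hv' : IsGridPt S w v')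
    (hu : u ∈ qbox j S v) (hu' : u ∈ qbox j S v') : v = v' :=
  eq_of_isGridPt_of_sub_mem_box hv hv' (mem_qbox.1 hu).2 (mem_qbox.1 hu').2

open scoped Classical in
/-- The grid points whose boxes meet `Q_j`. [cite: KozmaNachmias2011, §4.4 (the finite set G(w))] -/
def gridPts (j S : ℕ) (w : Site d) : Finset (Site d) :=
  (box d (j + 2 * S)).filter fun v => IsGridPt S w v ∧ (qbox j S v).Nonempty

/-- Membership in `gridPts`. [folklore] -/
theorem mem_gridPts {j S : ℕ} {w v : Site d} :
    v ∈ gridPts j S w ↔ v ∈ box d (j + 2 * S) ∧ IsGridPt S w v ∧ (qbox j S v).Nonempty := by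
  rw [gridPts, Finset.mem_filter]

/-- A grid point whose box meets `Q_j` lies in `Q_{j+2S}`. [folklore] -/
theorem mem_box_of_qbox_nonempty {j S : ℕ} {v : Site d} (h : (qbox j S v).Nonempty) : v ∈ box d (j + 2 * S) := by
  obtain ⟨u, hu⟩ := h
  obtain ⟨huj, huv⟩ := mem_qbox.1 hu
  rw [mem_box] at huj huv ⊢
  intro i
  obtain ⟨h1a, h1b⟩ := huj i
  obtain ⟨h2a, h2b⟩ := huv i
  simp only [Pi.sub_apply] at h2a h2b
  push_cast at h1a h1b h2a h2b ⊢
  constructor <;> linarith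

/-- `gridOf u ∈ gridPts` for `u ∈ Q_j`. [folklore] -/
theorem gridOf_mem_gridPts {j : ℕ} (S : ℕ) (w : Site d) {u : Site d} (hu : u ∈ box d j) :
    gridOf S w u ∈ gridPts j S w :=
  mem_gridPts.2 ⟨mem_box_of_qbox_nonempty ⟨u, mem_qbox_gridOf S w hu⟩, isGridPt_gridOf S w u,
    ⟨u, mem_qbox_gridOf S w hu⟩⟩

/-- **Boundary boxes**: `q_v` meets `∂Q_j`, i.e. some `x ∈ ∂Q_j` has `x - v ∈ Q_{2S}` — the
hypothesis of Corollary 3.2 for the box `q_v`. [cite: KozmaNachmias2011, §4.4 (E₁ = {q ∈ G : q ∩ ∂Q_j = ∅})] -/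
def IsBoundaryPt (j S : ℕ) (v : Site d) : Prop := ∃ x ∈ sphere d j, x - v ∈ box d (2 * S)

open scoped Classical in
/-- **The interior region** `⋃ E₁`: the union of the boxes not meeting `∂Q_j`, revealed at the
start ("`E₁ = {q ∈ G : q ∩ ∂Q_j = ∅}`"). [cite: KozmaNachmias2011, §4.4 (p. 393)] -/
def interior (j S : ℕ) (w : Site d) : Finset (Site d) :=
  (box d j).filter fun u => ¬IsBoundaryPt j S (gridOf S w u)

/-- Membership in the interior region. [folklore] -/
theorem mem_interior {j S : ℕ} {w u : Site d} : u ∈ interior j S w ↔ u ∈ box d j ∧ ¬IsBoundaryPt j S (gridOf S w u) :=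
  Finset.mem_filter

/-- A vertex of `∂Q_j` is not interior. [folklore] -/
theorem not_mem_interior_of_mem_sphere {j S : ℕ} {w x : Site d} (hx : x ∈ sphere d j) : x ∉ interior j S w := by
  intro h
  exact (mem_interior.1 h).2 ⟨x, hx, sub_gridOf_mem_box S w x⟩

/-- `|q_v| ≤ (4S+1)^d`. [folklore] -/
theorem card_qbox_le (j S : ℕ) (v : Site d) : #(qbox j S v) ≤ (4 * S + 1) ^ d := by
  have hsub : qbox j S v ⊆ (box d (2 * S)).image fun z => v + z := by
    intro u hu
    exact Finset.mem_image.2 ⟨u - v, (mem_qbox.1 hu).2, by abel⟩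
  calc #(qbox j S v) ≤ #((box d (2 * S)).image fun z => v + z) := Finset.card_le_card hsub
    _ ≤ #(box d (2 * S)) := Finset.card_image_le
    _ = (4 * S + 1) ^ d := by rw [card_box]; congr 1; ring

end Grid

/-! ### The exploration as an `Explorer` -/

section ExplorerDef

/-- The vertices of `Q_j` recorded in a probe support `D`: those `u` whose diagonal pair `s(u,u)`
lies in `D` (every support of the exploration consists of the pairs of `Q_j` touching a vertex set,
which is thereby recovered). [folklore] -/
def verts (j : ℕ) (D : Finset (Sym2 (Site d))) : Finset (Site d) := (box d j).filter fun u => s(u, u) ∈ D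

/-- **The explored region** `⋃ E_i` of a history: the vertices recorded in its probe supports.
[cite: KozmaNachmias2011, §4.4 (the explored boxes E_i)] -/
def explored (j : ℕ) (h : ProbeHistory (Site d)) : Finset (Site d) :=
  (h.filterMap id).toFinset.biUnion fun r => verts j r.1

/-- The open pairs revealed along a history. [folklore] -/
def openObs (h : ProbeHistory (Site d)) : Finset (Sym2 (Site d)) := (h.filterMap id).toFinset.biUnion Prod.snd

open scoped Classical in
/-- **The revealed cluster of the origin**: the vertices of the explored region joined to `0` by
revealed open pairs inside the explored region ("`0 ↔ x` through `⋃ E_i`").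
[cite: KozmaNachmias2011, §4.4 (definition of A_i)] -/
def known (j : ℕ) (h : ProbeHistory (Site d)) : Finset (Site d) :=
  (explored j h).filter fun u =>
    (↑(openObs h) : Set (Sym2 (Site d))) ∈ openConnIn (↑(explored j h) : Set (Site d)) (0 : Site d) u

open scoped Classical in
/-- The pairs of `Q_j` touching a vertex set `Q`. [folklore] -/
def pairsTouching (j : ℕ) (Q : Finset (Site d)) : Finset (Sym2 (Site d)) :=
  (box d j).sym2.filter fun e => ∃ z ∈ Q, z ∈ e

/-- Membership in `pairsTouching`. [folklore] -/
theorem mk_mem_pairsTouching {j : ℕ} {Q : Finset (Site d)} {a b : Site d} :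
    s(a, b) ∈ pairsTouching j Q ↔ (a ∈ box d j ∧ b ∈ box d j) ∧ (a ∈ Q ∨ b ∈ Q) := by
  simp only [pairsTouching, Finset.mem_filter, Finset.mk_mem_sym2_iff, Sym2.mem_iff]
  constructor
  · rintro ⟨hab, z, hz, rfl | rfl⟩
    · exact ⟨hab, Or.inl hz⟩
    · exact ⟨hab, Or.inr hz⟩
  · rintro ⟨hab, ha | hb⟩
    · exact ⟨hab, a, ha, Or.inl rfl⟩
    · exact ⟨hab, b, hb, Or.inr rfl⟩

/-- The pairs inside a subset of `Q_j` touch it. [folklore] -/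
theorem sym2_subset_pairsTouching {j : ℕ} {Q : Finset (Site d)} (hQ : Q ⊆ box d j) : Q.sym2 ⊆ pairsTouching j Q := by
  intro e he
  induction e using Sym2.ind with
  | h a b =>
    obtain ⟨ha, hb⟩ := Finset.mk_mem_sym2_iff.1 he
    exact mk_mem_pairsTouching.2 ⟨⟨hQ ha, hQ hb⟩, Or.inl ha⟩

/-- **Active boxes** after a history (Kozma–Nachmias 2011, §4.4: the unexplored boxes `q` with some
`x ∈ ∂q` joined to `0` through the explored boxes): an unexplored boundary box `q_v`, none of whose
pairs has been revealed, containing a vertex `z` joined by a revealed open pair to the revealed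
cluster of the origin. [cite: KozmaNachmias2011, §4.4 (definition of A_i, p. 393–394)] -/
def IsActive (j S : ℕ) (w : Site d) (h : ProbeHistory (Site d)) (v : Site d) : Prop :=
  v ∈ gridPts j S w ∧ IsBoundaryPt j S v ∧ Disjoint (qbox j S v) (explored j h) ∧
    Disjoint (qbox j S v).sym2 (supp h) ∧
    ∃ z ∈ qbox j S v, ∃ u ∈ known j h, s(u, z) ∈ openObs h ∧ u ≠ z

open scoped Classical in
/-- **The next probe** (Kozma–Nachmias 2011, §4.4): at the start, all pairs of `Q_j` touching the
interior region (the boxes of `E₁`); afterwards, while some box is active, the pairs of `Q_j`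
touching a chosen active box that have not been revealed; otherwise the exploration has finished.
[cite: KozmaNachmias2011, §4.4 (the exploration process, pp. 393–394)] -/
def knNext (j S : ℕ) (w : Site d) (h : ProbeHistory (Site d)) : Option (Finset (Sym2 (Site d))) :=
  if h = [] then some (pairsTouching j (interior j S w))
  else if hex : ∃ v, IsActive j S w h v then some (pairsTouching j (qbox j S (Classical.choose hex)) \ supp h)
  else none

/-- **The exploration of `C(0; Q_j)` in boxes** as an `Explorer`. [cite: KozmaNachmias2011, §4.4] -/
def knExplorer (j S : ℕ) (w : Site d) : Explorer (Site d) := ⟨knNext j S w⟩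

/-- The designated probes: all but the first (interior) one — the explored boxes `q_1, q_2, …`
counted by the stopping time `τ`. [cite: KozmaNachmias2011, §4.4 (the stopping time τ)] -/
def knDesig (h : ProbeHistory (Site d)) : Prop := h ≠ []

/-- The active grid point chosen after a non-initial history with an active box. [folklore] -/
def chosenPt {j S : ℕ} {w : Site d} {h : ProbeHistory (Site d)} (hex : ∃ v, IsActive j S w h v) : Site d :=
  Classical.choose hex

/-- The chosen point is active. [folklore] -/
theorem isActive_chosenPt {j S : ℕ} {w : Site d} {h : ProbeHistory (Site d)} (hex : ∃ v, IsActive j S w h v) :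
    IsActive j S w h (chosenPt hex) :=
  Classical.choose_spec hex

/-- **The entry vertex** `z ∈ ∂q` of the chosen box ("there exists some `z ∈ ∂q_k` which is
connected to `0` in `E_{k-1}`", proof of Lemma 4.5). [cite: KozmaNachmias2011, proof of Lemma 4.5 (p. 394)] -/
def entry {j S : ℕ} {w : Site d} {h : ProbeHistory (Site d)} (hex : ∃ v, IsActive j S w h v) : Site d :=
  Classical.choose (isActive_chosenPt hex).2.2.2.2

/-- The entry vertex lies in the chosen box and is joined to the revealed cluster by a revealed open
pair. [cite: KozmaNachmias2011, proof of Lemma 4.5 (p. 394)] -/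
theorem entry_spec {j S : ℕ} {w : Site d} {h : ProbeHistory (Site d)} (hex : ∃ v, IsActive j S w h v) :
    entry hex ∈ qbox j S (chosenPt hex) ∧
      ∃ u ∈ known j h, s(u, entry hex) ∈ openObs h ∧ u ≠ entry hex :=
  Classical.choose_spec (isActive_chosenPt hex).2.2.2.2

/-- The next probe after the empty history is the interior probe. [folklore] -/
theorem knNext_nil (j S : ℕ) (w : Site d) :
    knNext j S w ([] : ProbeHistory (Site d)) = some (pairsTouching j (interior j S w)) := by
  simp [knNext]

/-- The next probe after a non-initial history with an active box. [folklore] -/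
theorem knNext_of_active {j S : ℕ} {w : Site d} {h : ProbeHistory (Site d)} (hh : h ≠ [])
    (hex : ∃ v, IsActive j S w h v) :
    knNext j S w h = some (pairsTouching j (qbox j S (chosenPt hex)) \ supp h) := by
  simp only [knNext, hh, if_false, dif_pos hex]; rfl

/-- No next probe after a non-initial history without active boxes. [folklore] -/
theorem knNext_of_not_active {j S : ℕ} {w : Site d} {h : ProbeHistory (Site d)} (hh : h ≠ [])
    (hex : ¬∃ v, IsActive j S w h v) : knNext j S w h = none := by
  simp only [knNext, hh, if_false, dif_neg hex]

/-- A designated probe is made only at an active box, and its support contains the pairs of that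
box. [folklore] -/
theorem exists_active_of_knNext {j S : ℕ} {w : Site d} {h : ProbeHistory (Site d)} {D : Finset (Sym2 (Site d))}
    (hD : knNext j S w h = some D) (hh : knDesig h) :
    ∃ hex : ∃ v, IsActive j S w h v, D = pairsTouching j (qbox j S (chosenPt hex)) \ supp h ∧
      (qbox j S (chosenPt hex)).sym2 ⊆ D := by
  by_cases hex : ∃ v, IsActive j S w h v
  · refine ⟨hex, ?_, ?_⟩
    · rw [knNext_of_active hh hex] at hD; exact (Option.some.inj hD).symm
    · rw [knNext_of_active hh hex] at hD
      rw [← Option.some.inj hD]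
      intro e he
      refine Finset.mem_sdiff.2 ⟨sym2_subset_pairsTouching (qbox_subset_box j S _) he, ?_⟩
      exact Finset.disjoint_left.1 (isActive_chosenPt hex).2.2.2.1 he
  · rw [knNext_of_not_active hh hex] at hD; cases hD

/-- **Freshness** of the exploration: every probe avoids the supports of the earlier ones.
[cite: KozmaNachmias2011, §4.4 (the filtration F_i of the explored boxes)] -/
theorem knExplorer_fresh (j S : ℕ) (w : Site d) : (knExplorer j S w).Fresh (∅ : Set (Sym2 (Site d))) := by
  intro h D hD
  refine ⟨Set.disjoint_empty _, ?_⟩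
  change knNext j S w h = some D at hD
  by_cases hh : h = []
  · subst hh; simp
  · obtain ⟨hex, rfl, -⟩ := exists_active_of_knNext hD hh
    exact Finset.sdiff_disjoint

end ExplorerDef

/-! ### The two designated-probe predicates and their conditional probabilities -/

section Predicates

variable {j S : ℕ} {w : Site d}

/-- **Boundary hit** read off the observation `o` of the probe made after `h`: the entry vertex of
the chosen box is joined to `∂Q_j` inside the box by observed open pairs ("the probability that
there exists `x ∈ q_k ∩ ∂Q_j` such that `0 ↔ x` is at least the probability that `z ↔ ∂Q_j` in
`q_k`", proof of Lemma 4.5). [cite: KozmaNachmias2011, proof of Lemma 4.5 (p. 394)] -/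
def hitPred (j S : ℕ) (w : Site d) (h : ProbeHistory (Site d)) (o : Finset (Sym2 (Site d))) : Prop :=
  ∃ hex : h ≠ [] ∧ ∃ v, IsActive j S w h v,
    ∃ x ∈ sphere d j, (↑o : Set (Sym2 (Site d))) ∈
      openConnIn (↑(qbox j S (chosenPt hex.2)) : Set (Site d)) (entry hex.2) x

/-- **Bad box** read off the observation: the observed configuration lies in the (abstract) bad
event of the chosen box ("`q_i` is `s`-bad", §4.4). [cite: KozmaNachmias2011, §4.4 (definition of an s-bad box, p. 394)] -/
def badPred (j S : ℕ) (w : Site d) (Bad : Site d → Set (BondConfig (Site d))) (h : ProbeHistory (Site d))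
    (o : Finset (Sym2 (Site d))) : Prop :=
  ∃ hex : h ≠ [] ∧ ∃ v, IsActive j S w h v, (↑o : Set (Sym2 (Site d))) ∈ Bad (chosenPt hex.2)

/-- An observation over a support containing the pairs of a set agrees with the configuration on
those pairs. [folklore] -/
theorem coe_obs_inter_eq {ω : BondConfig (Site d)} {D : Finset (Sym2 (Site d))} {K : Finset (Sym2 (Site d))}
    (hK : K ⊆ D) : (↑(obs ω D) : Set (Sym2 (Site d))) ∩ ↑K = ω ∩ ↑K := by
  rw [coe_obs, Set.inter_assoc, Set.inter_eq_self_of_subset_right (Finset.coe_subset.2 hK)]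

/-- **The boundary-hit probability** (Kozma–Nachmias 2011, proof of Lemma 4.5: "by Corollary 3.2
is at least `c e^{-C log²(2s^{4d²})}`"): after every non-initial history at which a probe is made,
the probe hits `∂Q_j` with probability at least the Corollary 3.2 bound for the chosen boundary
box. [cite: KozmaNachmias2011, proof of Lemma 4.5 (p. 394)] -/
theorem le_real_hit (p : unitInterval) {c C : ℝ}
    (hcor : ∀ (x : Site d), (∃ w' ∈ sphere d j, w' - x ∈ box d (2 * S)) → ∀ y ∈ box d j, y - x ∈ box d (2 * S) →
      c * Real.exp (-C * Real.log ↑(2 * S) ^ 2) ≤ (bondPercolation (zdGraph d) p).real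
        {ω | ∃ w' ∈ sphere d j, ω ∈ openConnIn (↑((box d j).filter fun u => u - x ∈ box d (2 * S)) : Set (Site d)) y w'})
    (h : ProbeHistory (Site d)) (D : Finset (Sym2 (Site d))) (hD : (knExplorer j S w).next h = some D) (hh : knDesig h) :
    c * Real.exp (-C * Real.log ↑(2 * S) ^ 2) ≤
      (bondPercolation (zdGraph d) p).real {ω | hitPred j S w h (obs ω D)} := by
  obtain ⟨hex, hDeq, hsub⟩ := exists_active_of_knNext hD hh
  have hact := isActive_chosenPt hex
  obtain ⟨hz, -⟩ := entry_spec hex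
  set v := chosenPt hex with hv
  set z := entry hex with hz'
  have hkey : {ω : BondConfig (Site d) | hitPred j S w h (obs ω D)} =
      {ω | ∃ w' ∈ sphere d j, ω ∈ openConnIn (↑(qbox j S v) : Set (Site d)) z w'} := by
    ext ω
    simp only [Set.mem_setOf_eq, hitPred]
    constructor
    · rintro ⟨hex', x, hx, hconn⟩
      have he : HEq hex'.2 hex := proof_irrel_heq _ _
      refine ⟨x, hx, ?_⟩
      have := (determinedBy_iff _ _).1 (determinedBy_openConnIn (↑(qbox j S v)) z x
        (K := ↑(qbox j S v).sym2) (by rw [Finset.coe_sym2])) _ ω (coe_obs_inter_eq hsub)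
      exact this.1 hconn
    · rintro ⟨x, hx, hconn⟩
      refine ⟨⟨hh, hex⟩, x, hx, ?_⟩
      have := (determinedBy_iff _ _).1 (determinedBy_openConnIn (↑(qbox j S v)) z x
        (K := ↑(qbox j S v).sym2) (by rw [Finset.coe_sym2])) _ ω (coe_obs_inter_eq hsub)
      exact this.2 hconn
  rw [hkey]
  exact hcor v hact.2.1 z (qbox_subset_box j S v hz) (mem_qbox.1 hz).2

/-- **The bad-box probability** (Kozma–Nachmias 2011, proof of Lemma 4.6: "by locality,
`P(q_k is bad | F_{k-1}) = P(q is bad) ≤ …`"): if the bad event of each boundary box is determined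
by the pairs of the box and has probability at most `ρ`, then after every non-initial history the
next probe is bad with probability at most `ρ`. [cite: KozmaNachmias2011, proof of Lemma 4.6 (pp. 395–396)] -/
theorem real_bad_le (p : unitInterval) {Bad : Site d → Set (BondConfig (Site d))} {ρ : ℝ}
    (hdet : ∀ v ∈ gridPts j S w, DeterminedBy (Bad v) ↑(qbox j S v).sym2)
    (hρ : ∀ v ∈ gridPts j S w, IsBoundaryPt j S v → (bondPercolation (zdGraph d) p).real (Bad v) ≤ ρ)
    (h : ProbeHistory (Site d)) (D : Finset (Sym2 (Site d))) (hD : (knExplorer j S w).next h = some D) (hh : knDesig h) :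
    (bondPercolation (zdGraph d) p).real {ω | badPred j S w Bad h (obs ω D)} ≤ ρ := by
  obtain ⟨hex, hDeq, hsub⟩ := exists_active_of_knNext hD hh
  have hact := isActive_chosenPt hex
  set v := chosenPt hex with hv
  have hkey : {ω : BondConfig (Site d) | badPred j S w Bad h (obs ω D)} = Bad v := by
    ext ω
    simp only [Set.mem_setOf_eq, badPred]
    have := (determinedBy_iff _ _).1 (hdet v hact.1) _ ω (coe_obs_inter_eq hsub)
    constructor
    · rintro ⟨hex', hbad⟩; exact this.1 hbad
    · intro hbad; exact ⟨⟨hh, hex⟩, this.2 hbad⟩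
  rw [hkey]
  exact hρ v hact.1 hact.2.1

/-- **Lemma 4.5 in Chernoff form** (few boundary hits among many explored boxes): if Corollary 3.2
holds with constants `c, C` for the boxes of half-width `2S`, then with `μ₀ = c e^{-C log²(2S)} ≤ 1`,
for all `t ≥ 0`, `n, i` and real `a`,
`P(#{hits among the first n steps} ≤ a and ≥ i boxes explored) ≤ e^{ta} (1 - μ₀(1 - e^{-t}))^i`.
[cite: KozmaNachmias2011, Lemma 4.5 (p. 394)] -/
theorem real_few_hits_le (p : unitInterval) {c C : ℝ} (hc0 : 0 ≤ c * Real.exp (-C * Real.log ↑(2 * S) ^ 2))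
    (hc1 : c * Real.exp (-C * Real.log ↑(2 * S) ^ 2) ≤ 1)
    (hcor : ∀ (x : Site d), (∃ w' ∈ sphere d j, w' - x ∈ box d (2 * S)) → ∀ y ∈ box d j, y - x ∈ box d (2 * S) →
      c * Real.exp (-C * Real.log ↑(2 * S) ^ 2) ≤ (bondPercolation (zdGraph d) p).real
        {ω | ∃ w' ∈ sphere d j, ω ∈ openConnIn (↑((box d j).filter fun u => u - x ∈ box d (2 * S)) : Set (Site d)) y w'})
    {t : ℝ} (ht : 0 ≤ t) (n i : ℕ) (a : ℝ) :
    (bondPercolation (zdGraph d) p).real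
        {ω | (nfail (fun h o => ¬hitPred j S w h o) knDesig ((knExplorer j S w).hist n ω) : ℝ) ≤ a ∧
          i ≤ ndesig knDesig ((knExplorer j S w).hist n ω)} ≤
      Real.exp (t * a) * (1 - c * Real.exp (-C * Real.log ↑(2 * S) ^ 2) * (1 - Real.exp (-t))) ^ i := by
  have h := (knExplorer j S w).measureReal_inter_le_of_le_failProb (zdGraph d) p (fun h o => ¬hitPred j S w h o) knDesig
    (knExplorer_fresh j S w) (determinedBy_univ ∅) MeasurableSet.univ hc0 hc1
    (fun h D hD hh => by
      simp only [not_not]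
      exact le_real_hit p hcor h D hD hh) ht n i a
  rwa [Set.univ_inter, probReal_univ, mul_one] at h

/-- **Lemma 4.6 in Chernoff form** (many bad boxes among few explored boxes): if the bad events are
determined by the pairs of their boxes and have probability at most `ρ ≥ 0`, then for all `t ≥ 0`,
`n, i` and real `a`,
`P(#{bad boxes among the first n steps} ≥ a and ≤ i boxes explored) ≤ e^{-ta} (1 + ρ(e^t - 1))^i`.
[cite: KozmaNachmias2011, Lemma 4.6 (p. 395)] -/
theorem real_many_bad_le (p : unitInterval) {Bad : Site d → Set (BondConfig (Site d))} {ρ : ℝ} (hρ0 : 0 ≤ ρ)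
    (hdet : ∀ v ∈ gridPts j S w, DeterminedBy (Bad v) ↑(qbox j S v).sym2)
    (hρ : ∀ v ∈ gridPts j S w, IsBoundaryPt j S v → (bondPercolation (zdGraph d) p).real (Bad v) ≤ ρ)
    {t : ℝ} (ht : 0 ≤ t) (n i : ℕ) (a : ℝ) :
    (bondPercolation (zdGraph d) p).real
        {ω | a ≤ nfail (fun h o => ¬badPred j S w Bad h o) knDesig ((knExplorer j S w).hist n ω) ∧
          ndesig knDesig ((knExplorer j S w).hist n ω) ≤ i} ≤
      Real.exp (-(t * a)) * (1 + ρ * (Real.exp t - 1)) ^ i := by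
  have h := (knExplorer j S w).measureReal_inter_le_of_failProb_le (zdGraph d) p (fun h o => ¬badPred j S w Bad h o)
    knDesig (knExplorer_fresh j S w) (determinedBy_univ ∅) MeasurableSet.univ hρ0
    (fun h D hD hh => by
      simp only [not_not]
      exact real_bad_le p hdet hρ h D hD hh) ht n i a
  rwa [Set.univ_inter, probReal_univ, mul_one] at h

end Predicates

/-! ### Bookkeeping of genuine histories -/

section Histories

variable {j S : ℕ} {w : Site d}

/-- `supp` after a probe, with this file's decidability instances (the statement of
`ProbeHistory.supp_cons_some` carries the classical `DecidableEq` of `SequentialProbing.lean`).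
[folklore] -/
theorem supp_cons_some' (r : ProbeRecord (Site d)) (h : ProbeHistory (Site d)) :
    supp (some r :: h) = r.1 ∪ supp h := by
  ext e
  rw [Finset.mem_union, mem_supp_iff, mem_supp_iff]
  constructor
  · rintro ⟨r', hr', he⟩
    rcases List.mem_cons.1 hr' with h1 | h1
    · exact Or.inl (Option.some.inj h1 ▸ he)
    · exact Or.inr ⟨r', h1, he⟩
  · rintro (he | ⟨r', hr', he⟩)
    · exact ⟨r, List.mem_cons_self, he⟩
    · exact ⟨r', List.mem_cons_of_mem _ hr', he⟩

/-- `explored` ignores `none` steps. [folklore] -/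
@[simp] theorem explored_cons_none (j : ℕ) (h : ProbeHistory (Site d)) : explored j (none :: h) = explored j h := by
  simp [explored]

/-- `explored` after a probe. [folklore] -/
@[simp] theorem explored_cons_some (j : ℕ) (r : ProbeRecord (Site d)) (h : ProbeHistory (Site d)) :
    explored j (some r :: h) = verts j r.1 ∪ explored j h := by
  simp [explored, Finset.biUnion_insert]

/-- `openObs` ignores `none` steps. [folklore] -/
@[simp] theorem openObs_cons_none (h : ProbeHistory (Site d)) : openObs (none :: h) = openObs h := by
  simp [openObs]

/-- `openObs` after a probe. [folklore] -/
@[simp] theorem openObs_cons_some (r : ProbeRecord (Site d)) (h : ProbeHistory (Site d)) :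
    openObs (some r :: h) = r.2 ∪ openObs h := by
  simp [openObs, Finset.biUnion_insert]

/-- `explored [] = ∅`. [folklore] -/
@[simp] theorem explored_nil (j : ℕ) : explored j ([] : ProbeHistory (Site d)) = ∅ := by simp [explored]

/-- `openObs [] = ∅`. [folklore] -/
@[simp] theorem openObs_nil : openObs ([] : ProbeHistory (Site d)) = ∅ := by simp [openObs]

/-- `known` ignores `none` steps. [folklore] -/
@[simp] theorem known_cons_none (j : ℕ) (h : ProbeHistory (Site d)) : known j (none :: h) = known j h := by
  unfold known; rw [explored_cons_none, openObs_cons_none]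

/-- Activity ignores `none` steps. [folklore] -/
theorem isActive_cons_none {h : ProbeHistory (Site d)} {v : Site d} :
    IsActive j S w (none :: h) v ↔ IsActive j S w h v := by
  simp only [IsActive, explored_cons_none, supp_cons_none, known_cons_none, openObs_cons_none]

/-- Once stopped (after a non-initial history), the exploration stays stopped. [folklore] -/
theorem knNext_cons_none {h : ProbeHistory (Site d)} (hh : h ≠ []) (hn : knNext j S w h = none) :
    knNext j S w (none :: h) = none := by
  have hex : ¬∃ v, IsActive j S w h v := fun hex => by rw [knNext_of_active hh hex] at hn; cases hn
  exact knNext_of_not_active (List.cons_ne_nil _ _) (by simpa only [isActive_cons_none] using hex)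

/-- The vertices recorded in the pairs touching a subset of `Q_j` are that subset. [folklore] -/
theorem verts_pairsTouching {j : ℕ} {Q : Finset (Site d)} (hQ : Q ⊆ box d j) : verts j (pairsTouching j Q) = Q := by
  ext u
  simp only [verts, Finset.mem_filter, mk_mem_pairsTouching, or_self, and_self]
  constructor
  · rintro ⟨-, -, hu⟩; exact hu
  · intro hu; exact ⟨hQ hu, hQ hu, hu⟩

/-- The vertices recorded in a designated support are the chosen box. [folklore] -/
theorem verts_sdiff_eq {j S : ℕ} {w : Site d} {h : ProbeHistory (Site d)} (hex : ∃ v, IsActive j S w h v) :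
    verts j (pairsTouching j (qbox j S (chosenPt hex)) \ supp h) = qbox j S (chosenPt hex) := by
  have hact := isActive_chosenPt hex
  ext u
  simp only [verts, Finset.mem_filter, Finset.mem_sdiff, mk_mem_pairsTouching, or_self, and_self]
  constructor
  · rintro ⟨-, ⟨-, hu⟩, -⟩; exact hu
  · intro hu
    refine ⟨qbox_subset_box j S _ hu, ⟨qbox_subset_box j S _ hu, hu⟩, ?_⟩
    exact Finset.disjoint_left.1 hact.2.2.2.1 (Finset.mk_mem_sym2_iff.2 ⟨hu, hu⟩)

/-- `pairsTouching` of a union. [folklore] -/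
theorem pairsTouching_union (j : ℕ) (Q R : Finset (Site d)) :
    pairsTouching j (Q ∪ R) = pairsTouching j Q ∪ pairsTouching j R := by
  ext e
  simp only [pairsTouching, Finset.mem_filter, Finset.mem_union]
  constructor
  · rintro ⟨he, z, hz, hze⟩
    rcases hz with hz | hz
    · exact Or.inl ⟨he, z, hz, hze⟩
    · exact Or.inr ⟨he, z, hz, hze⟩
  · rintro (⟨he, z, hz, hze⟩ | ⟨he, z, hz, hze⟩)
    · exact ⟨he, z, Or.inl hz, hze⟩
    · exact ⟨he, z, Or.inr hz, hze⟩

/-- `pairsTouching ∅ = ∅`. [folklore] -/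
@[simp] theorem pairsTouching_empty (j : ℕ) : pairsTouching j (∅ : Finset (Site d)) = ∅ := by
  ext e; simp [pairsTouching]

open scoped Classical in
/-- **The explored boundary grid points** of a history: those whose box lies in the explored region.
[cite: KozmaNachmias2011, §4.4 (the explored boxes q_1, …, q_i)] -/
def exploredPts (j S : ℕ) (w : Site d) (h : ProbeHistory (Site d)) : Finset (Site d) :=
  (gridPts j S w).filter fun v => IsBoundaryPt j S v ∧ qbox j S v ⊆ explored j h

/-- Membership in `exploredPts`. [folklore] -/
theorem mem_exploredPts {h : ProbeHistory (Site d)} {v : Site d} :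
    v ∈ exploredPts j S w h ↔ v ∈ gridPts j S w ∧ IsBoundaryPt j S v ∧ qbox j S v ⊆ explored j h :=
  Finset.mem_filter

/-- `exploredPts` ignores `none` steps. [folklore] -/
@[simp] theorem exploredPts_cons_none (h : ProbeHistory (Site d)) :
    exploredPts j S w (none :: h) = exploredPts j S w h := by
  unfold exploredPts; rw [explored_cons_none]

/-- No boundary box is explored by the empty history. [folklore] -/
theorem exploredPts_nil : exploredPts j S w ([] : ProbeHistory (Site d)) = ∅ := by
  ext v
  simp only [mem_exploredPts, explored_nil, Finset.subset_empty, Finset.notMem_empty, iff_false, not_and]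
  intro hv _ hq
  exact (mem_gridPts.1 hv).2.2.ne_empty hq

/-- A boundary box is not contained in the interior region. [folklore] -/
theorem not_qbox_subset_interior {v : Site d} (hb : IsBoundaryPt j S v) :
    ¬qbox j S v ⊆ interior j S w := by
  rintro hsub
  obtain ⟨x, hx, hxv⟩ := hb
  have hxq : x ∈ qbox j S v := mem_qbox.2 ⟨sphere_subset_box d j hx, hxv⟩
  exact not_mem_interior_of_mem_sphere hx (hsub hxq)

/-- A boundary box is disjoint from the interior region (the interior is a union of boxes of
non-boundary grid points, and boxes of distinct grid points are disjoint). [folklore] -/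
theorem disjoint_qbox_interior {v : Site d} (hv : IsGridPt S w v) (hb : IsBoundaryPt j S v) :
    Disjoint (qbox j S v) (interior j S w) := by
  refine Finset.disjoint_left.2 fun u hu hui => ?_
  obtain ⟨huj, hnb⟩ := mem_interior.1 hui
  have := eq_of_mem_qbox_of_mem_qbox hv (isGridPt_gridOf S w u) hu (mem_qbox_gridOf S w huj)
  exact hnb (this ▸ hb)

/-- The explored points after a designated step: the chosen point is added. [folklore] -/
theorem exploredPts_step {h : ProbeHistory (Site d)} (hex : ∃ v, IsActive j S w h v) (o : Finset (Sym2 (Site d))) :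
    exploredPts j S w (some (pairsTouching j (qbox j S (chosenPt hex)) \ supp h, o) :: h) =
      insert (chosenPt hex) (exploredPts j S w h) := by
  have hact := isActive_chosenPt hex
  have hexpl : explored j (some (pairsTouching j (qbox j S (chosenPt hex)) \ supp h, o) :: h) =
      qbox j S (chosenPt hex) ∪ explored j h := by
    rw [explored_cons_some]
    exact congrArg (· ∪ explored j h) (verts_sdiff_eq hex)
  ext v''
  rw [mem_exploredPts, hexpl, Finset.mem_insert, mem_exploredPts]
  constructor
  · rintro ⟨hv'', hb'', hsub⟩
    by_cases hmeet : ∃ u, u ∈ qbox j S v'' ∧ u ∈ qbox j S (chosenPt hex)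
    · obtain ⟨u, hu1, hu2⟩ := hmeet
      exact Or.inl (eq_of_mem_qbox_of_mem_qbox (mem_gridPts.1 hv'').2.1 (mem_gridPts.1 hact.1).2.1 hu1 hu2)
    · refine Or.inr ⟨hv'', hb'', fun u hu => ?_⟩
      rcases Finset.mem_union.1 (hsub hu) with h1 | h1
      · exact absurd ⟨u, hu, h1⟩ hmeet
      · exact h1
  · rintro (rfl | ⟨hv'', hb'', hsub⟩)
    · exact ⟨hact.1, hact.2.1, Finset.subset_union_left⟩
    · exact ⟨hv'', hb'', hsub.trans Finset.subset_union_right⟩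

/-- The chosen point was not explored before. [folklore] -/
theorem chosenPt_not_mem_exploredPts {h : ProbeHistory (Site d)} (hex : ∃ v, IsActive j S w h v) :
    chosenPt hex ∉ exploredPts j S w h := by
  have hact := isActive_chosenPt hex
  intro hmem
  obtain ⟨u, hu⟩ := (mem_gridPts.1 hact.1).2.2
  exact Finset.disjoint_left.1 hact.2.2.1 hu ((mem_exploredPts.1 hmem).2.2 hu)

/-- **The invariants of a genuine history** `h = hist n ω` of the exploration. [folklore] -/
structure HistInv (j S : ℕ) (w : Site d) (Bad : Site d → Set (BondConfig (Site d))) (ω : BondConfig (Site d))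
    (h : ProbeHistory (Site d)) : Prop where
  /-- the revealed open pairs are the open pairs of `ω` among the revealed pairs -/
  obs : ∀ e, e ∈ openObs h ↔ e ∈ ω ∧ e ∈ supp h
  /-- the revealed pairs are the pairs of `Q_j` touching the explored region -/
  supp_eq : supp h = pairsTouching j (explored j h)
  /-- the explored region is empty at the start, and afterwards the interior region plus the
  explored boundary boxes -/
  expl : (h = [] ∧ explored j h = ∅) ∨
    (h ≠ [] ∧ explored j h = interior j S w ∪ (exploredPts j S w h).biUnion (qbox j S))
  /-- the designated probes are the explored boundary boxes -/
  nd : ndesig knDesig h = #(exploredPts j S w h)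
  /-- the bad designated probes are the explored bad boxes -/
  bad : nfail (fun h o => ¬badPred j S w Bad h o) knDesig h = #((exploredPts j S w h).filter fun v => ω ∈ Bad v)
  /-- each hit produced its own vertex of `∂Q_j` joined to `0` inside `Q_j` -/
  hit : ∃ Xs ⊆ (sphere d j).filter (fun x => ω ∈ openConnIn (↑(box d j) : Set (Site d)) (0 : Site d) x),
    #Xs = nfail (fun h o => ¬hitPred j S w h o) knDesig h ∧ ∀ x ∈ Xs, ∃ v ∈ exploredPts j S w h, x ∈ qbox j S v

/-- The explored region lies in `Q_j`. [folklore] -/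
theorem explored_subset_box (j : ℕ) (h : ProbeHistory (Site d)) : explored j h ⊆ box d j := by
  intro u hu
  simp only [explored, Finset.mem_biUnion] at hu
  obtain ⟨r, -, hr⟩ := hu
  exact (Finset.mem_filter.1 hr).1

/-- For a genuine history, the revealed cluster of the origin is joined to `0` inside `Q_j`. [folklore] -/
theorem openConnIn_of_mem_known {Bad : Site d → Set (BondConfig (Site d))} {ω : BondConfig (Site d)}
    {h : ProbeHistory (Site d)} (hI : HistInv j S w Bad ω h) {u : Site d} (hu : u ∈ known j h) :
    ω ∈ openConnIn (↑(box d j) : Set (Site d)) (0 : Site d) u := by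
  obtain ⟨-, hconn⟩ := Finset.mem_filter.1 hu
  have hpath := mem_openConnIn_iff_pathIn.1 hconn
  have hsub : (↑(openObs h) : Set (Sym2 (Site d))) ⊆ ω := fun e he => ((hI.obs e).1 (Finset.mem_coe.1 he)).1
  exact mem_openConnIn_iff_pathIn.2 ((hpath.mono_graph (openGraph_mono hsub)).mono
    (Finset.coe_subset.2 (explored_subset_box j h)))

/-- **The invariants hold along the exploration.** [folklore] -/
theorem histInv_hist {Bad : Site d → Set (BondConfig (Site d))}
    (hdet : ∀ v ∈ gridPts j S w, DeterminedBy (Bad v) ↑(qbox j S v).sym2)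
    (ω : BondConfig (Site d)) : ∀ n, HistInv j S w Bad ω ((knExplorer j S w).hist n ω)
  | 0 => by
    refine ⟨fun e => by simp, by simp, Or.inl ⟨rfl, by simp⟩, ?_, ?_, ⟨∅, Finset.empty_subset _, by simp, by simp⟩⟩
    · rw [Explorer.hist_zero, exploredPts_nil]; rfl
    · rw [Explorer.hist_zero, exploredPts_nil]; simp
  | n + 1 => by
    have hI := histInv_hist hdet ω n
    set h := (knExplorer j S w).hist n ω with hh
    rw [Explorer.hist_succ]
    change HistInv j S w Bad ω ((knExplorer j S w).step h ω :: h)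
    rcases Option.eq_none_or_eq_some (knNext j S w h) with hnone | ⟨D, hD⟩
    · -- no probe: nothing changes
      have hstep : (knExplorer j S w).step h ω = none := (knExplorer j S w).step_of_none hnone ω
      rw [hstep]
      have hne : h ≠ [] := fun h0 => by rw [h0, knNext_nil] at hnone; cases hnone
      obtain ⟨Xs, hXs, hcard, hXv⟩ := hI.hit
      refine ⟨fun e => by simpa using hI.obs e, by simpa using hI.supp_eq, ?_, ?_, ?_, ⟨Xs, hXs, ?_, ?_⟩⟩
      · rcases hI.expl with ⟨h0, -⟩ | ⟨-, hex⟩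
        · exact absurd h0 hne
        · exact Or.inr ⟨List.cons_ne_nil _ _, by simpa using hex⟩
      · simpa using hI.nd
      · simpa using hI.bad
      · simpa using hcard
      · simpa using hXv
    · have hstep : (knExplorer j S w).step h ω = some (D, obs ω D) := (knExplorer j S w).step_of_some hD ω
      rw [hstep]
      by_cases h0 : h = []
      · -- the interior probe
        have hD' : D = pairsTouching j (interior j S w) := by
          rw [h0, knNext_nil] at hD; exact (Option.some.inj hD).symm
        have hInt : interior j S w ⊆ box d j := Finset.filter_subset _ _
        have hexpl : explored j (some (D, obs ω D) :: h) = interior j S w := by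
          rw [explored_cons_some, h0, explored_nil, Finset.union_empty, hD', verts_pairsTouching hInt]
        have hEP : exploredPts j S w (some (D, obs ω D) :: h) = ∅ := by
          ext v
          simp only [mem_exploredPts, hexpl, Finset.notMem_empty, iff_false, not_and]
          exact fun hv hb => not_qbox_subset_interior hb
        have hnd0 : ¬knDesig h := fun hk => hk h0
        refine ⟨fun e => ?_, ?_, Or.inr ⟨List.cons_ne_nil _ _, ?_⟩, ?_, ?_, ⟨∅, Finset.empty_subset _, ?_, by simp⟩⟩
        · rw [openObs_cons_some, supp_cons_some', h0, openObs_nil, supp_nil, Finset.union_empty, Finset.union_empty,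
            mem_obs_iff, and_comm]
        · rw [supp_cons_some', hexpl, h0, supp_nil, Finset.union_empty, hD']
        · rw [hexpl, hEP, Finset.biUnion_empty, Finset.union_empty]
        · rw [ndesig_cons_some, if_neg hnd0, hEP, h0]; simp
        · rw [nfail_cons_some, if_neg (fun hk => hnd0 hk.1), hEP, h0]; simp
        · rw [nfail_cons_some, if_neg (fun hk => hnd0 hk.1), h0]; simp
      · -- a designated probe at the chosen active box
        obtain ⟨hex, hDeq, hsub⟩ := exists_active_of_knNext hD h0
        have hact := isActive_chosenPt hex
        set v := chosenPt hex with hv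
        have hverts : verts j D = qbox j S v := by rw [hDeq]; exact verts_sdiff_eq hex
        have hexpl' : explored j (some (D, obs ω D) :: h) = qbox j S v ∪ explored j h := by
          rw [explored_cons_some, hverts]
        have hEP : exploredPts j S w (some (D, obs ω D) :: h) = insert v (exploredPts j S w h) := by
          rw [hDeq]; exact exploredPts_step hex _
        have hvEP : v ∉ exploredPts j S w h := chosenPt_not_mem_exploredPts hex
        have hkn : knDesig h := h0
        -- the new record's predicates
        have hbad_iff : badPred j S w Bad h (obs ω D) ↔ ω ∈ Bad v := by
          have := (determinedBy_iff _ _).1 (hdet v hact.1) _ ω (coe_obs_inter_eq hsub)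
          constructor
          · rintro ⟨hex', hb⟩; exact this.1 hb
          · intro hb; exact ⟨⟨h0, hex⟩, this.2 hb⟩
        obtain ⟨Xs, hXs, hcard, hXv⟩ := hI.hit
        refine ⟨fun e => ?_, ?_, Or.inr ⟨List.cons_ne_nil _ _, ?_⟩, ?_, ?_, ?_⟩
        · -- obs
          rw [openObs_cons_some, supp_cons_some', Finset.mem_union, Finset.mem_union, mem_obs_iff, hI.obs e]
          tauto
        · -- supp
          rw [supp_cons_some', hexpl', pairsTouching_union, hI.supp_eq]
          change D ∪ pairsTouching j (explored j h) = _
          rw [hDeq, ← hI.supp_eq, Finset.sdiff_union_self_eq_union]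
        · -- explored
          rcases hI.expl with ⟨h0', -⟩ | ⟨-, hexpl⟩
          · exact absurd h0' h0
          · rw [hexpl', hEP, Finset.biUnion_insert, hexpl]
            ext u; simp only [Finset.mem_union]; tauto
        · -- ndesig
          rw [ndesig_cons_some, if_pos hkn, hI.nd, hEP, Finset.card_insert_of_notMem hvEP]
        · -- bad
          rw [nfail_cons_some, hI.bad, hEP, Finset.filter_insert]
          by_cases hb : ω ∈ Bad v
          · rw [if_pos ⟨hkn, not_not.2 (hbad_iff.2 hb)⟩, if_pos hb, Finset.card_insert_of_notMem]
            exact fun hm => hvEP (Finset.mem_filter.1 hm).1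
          · rw [if_neg (fun hk => hb (hbad_iff.1 (not_not.1 hk.2))), if_neg hb, add_zero]
        · -- hit
          by_cases hhit : hitPred j S w h (obs ω D)
          · obtain ⟨hex', x, hx, hconn⟩ := hhit
            have hxe : (chosenPt hex'.2) = v := rfl
            rw [hxe] at hconn
            have hze : entry hex'.2 = entry hex := rfl
            rw [hze] at hconn
            -- `0 ↔ x` inside `Q_j`
            have hωconn : ω ∈ openConnIn (↑(qbox j S v) : Set (Site d)) (entry hex) x :=
              isUpperSet_openConnIn _ _ _ (show (↑(obs ω D) : Set (Sym2 (Site d))) ⊆ ω from fun e he =>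
                (mem_obs_iff.1 (Finset.mem_coe.1 he)).2) hconn
            obtain ⟨hzq, u, hu, huz, hne⟩ := entry_spec hex
            have h0u := openConnIn_of_mem_known hI hu
            have huzω : s(u, entry hex) ∈ ω := ((hI.obs _).1 huz).1
            have hzj : entry hex ∈ box d j := qbox_subset_box j S v hzq
            have h0z : ω ∈ openConnIn (↑(box d j) : Set (Site d)) 0 (entry hex) :=
              mem_openConnIn_iff_pathIn.2 ((mem_openConnIn_iff_pathIn.1 h0u).tail
                ((openGraph_adj ω _ _).2 ⟨huzω, hne⟩) (Finset.mem_coe.2 hzj))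
            have h0x : ω ∈ openConnIn (↑(box d j) : Set (Site d)) 0 x :=
              mem_openConnIn_iff_pathIn.2 ((mem_openConnIn_iff_pathIn.1 h0z).trans
                ((mem_openConnIn_iff_pathIn.1 hωconn).mono (Finset.coe_subset.2 (qbox_subset_box j S v))))
            have hxq : x ∈ qbox j S v := (pathIn_of_mem_openConnIn hωconn).right_mem
            have hxXs : x ∉ Xs := fun hxm => by
              obtain ⟨v'', hv'', hxv''⟩ := hXv x hxm
              have := eq_of_mem_qbox_of_mem_qbox (mem_gridPts.1 (mem_exploredPts.1 hv'').1).2.1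
                (mem_gridPts.1 hact.1).2.1 hxv'' hxq
              exact hvEP (this ▸ hv'')
            refine ⟨insert x Xs, ?_, ?_, ?_⟩
            · exact Finset.insert_subset (Finset.mem_filter.2 ⟨hx, h0x⟩) hXs
            · rw [Finset.card_insert_of_notMem hxXs, nfail_cons_some, hcard,
                if_pos ⟨hkn, not_not.2 ⟨hex', x, hx, hconn⟩⟩]
            · intro x' hx'
              rw [hEP]
              rcases Finset.mem_insert.1 hx' with rfl | hx'
              · exact ⟨v, Finset.mem_insert_self _ _, hxq⟩
              · obtain ⟨v'', hv'', hxv''⟩ := hXv x' hx'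
                exact ⟨v'', Finset.mem_insert_of_mem hv'', hxv''⟩
          · refine ⟨Xs, hXs, ?_, fun x hx => ?_⟩
            · rw [nfail_cons_some, hcard, if_neg (fun hk => hk.2 hhit), add_zero]
            · obtain ⟨v'', hv'', hxv''⟩ := hXv x hx
              exact ⟨v'', by rw [hEP]; exact Finset.mem_insert_of_mem hv'', hxv''⟩

end Histories

/-! ### Consequences: boundedness, stopping, completeness, and the two counts -/

section Consequences

variable {j S : ℕ} {w : Site d}

/-- The explored boundary points are grid points. [folklore] -/
theorem exploredPts_subset_gridPts (h : ProbeHistory (Site d)) : exploredPts j S w h ⊆ gridPts j S w :=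
  Finset.filter_subset _ _

/-- **At most `|G|` boxes are explored**: `τ ≤ |G(w)|` along every genuine history. [folklore] -/
theorem ndesig_hist_le (ω : BondConfig (Site d)) (n : ℕ) :
    ndesig knDesig ((knExplorer j S w).hist n ω) ≤ #(gridPts j S w) := by
  have hI := histInv_hist (j := j) (S := S) (w := w) (Bad := fun _ => (Set.univ : Set (BondConfig (Site d))))
    (fun v _ => determinedBy_univ _) ω n
  rw [hI.nd]
  exact Finset.card_le_card (exploredPts_subset_gridPts _)

/-- While the exploration is alive, every step after the first is a designated probe. [folklore] -/
theorem ndesig_hist_eq_of_alive (ω : BondConfig (Site d)) :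
    ∀ n, (∀ k, k < n → (knExplorer j S w).next ((knExplorer j S w).hist k ω) ≠ none) →
      ndesig knDesig ((knExplorer j S w).hist n ω) = n - 1
  | 0, _ => by simp
  | n + 1, halive => by
    have ih := ndesig_hist_eq_of_alive ω n fun k hk => halive k (Nat.lt_succ_of_lt hk)
    have hn := halive n (Nat.lt_succ_self n)
    obtain ⟨D, hD⟩ := Option.ne_none_iff_exists'.1 hn
    rw [Explorer.hist_succ, (knExplorer j S w).step_of_some hD, ndesig_cons_some, ih]
    rcases Nat.eq_zero_or_pos n with rfl | hpos
    · rw [if_neg (show ¬knDesig ((knExplorer j S w).hist 0 ω) from fun hk => hk rfl)]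
    · have hne : (knExplorer j S w).hist n ω ≠ [] := fun h0 => by
        have := (knExplorer j S w).length_hist n ω
        rw [h0, List.length_nil] at this
        omega
      rw [if_pos (show knDesig ((knExplorer j S w).hist n ω) from hne)]
      omega

/-- Once stopped, the exploration stays stopped. [folklore] -/
theorem next_hist_eq_none_of_le (ω : BondConfig (Site d)) {k m : ℕ} (hkm : k ≤ m)
    (hk : (knExplorer j S w).next ((knExplorer j S w).hist k ω) = none) :
    (knExplorer j S w).next ((knExplorer j S w).hist m ω) = none := by
  induction hkm with
  | refl => exact hk
  | @step m _ ih =>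
    rw [Explorer.hist_succ, (knExplorer j S w).step_of_none ih]
    have hne : (knExplorer j S w).hist m ω ≠ [] := fun h0 => by
      change knNext j S w ((knExplorer j S w).hist m ω) = none at ih
      rw [h0, knNext_nil] at ih; cases ih
    exact knNext_cons_none hne ih

/-- **The exploration has stopped by time `|G| + 2`** (one interior probe and at most `|G|`
designated probes). [cite: KozmaNachmias2011, §4.4 ("Since the set of boxes G is finite … at some time we must have A_i = ∅")] -/
theorem next_hist_eq_none (ω : BondConfig (Site d)) :
    (knExplorer j S w).next ((knExplorer j S w).hist (#(gridPts j S w) + 2) ω) = none := by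
  by_contra hN
  have halive : ∀ k, k < #(gridPts j S w) + 2 → (knExplorer j S w).next ((knExplorer j S w).hist k ω) ≠ none :=
    fun k hk hnone => hN (next_hist_eq_none_of_le ω hk.le hnone)
  have h1 := ndesig_hist_eq_of_alive ω _ halive
  have h2 := ndesig_hist_le (j := j) (S := S) (w := w) ω (#(gridPts j S w) + 2)
  omega

/-- A genuine history of positive length is non-empty. [folklore] -/
theorem hist_ne_nil (ω : BondConfig (Site d)) {n : ℕ} (hn : 1 ≤ n) : (knExplorer j S w).hist n ω ≠ [] := fun h0 => by
  have := (knExplorer j S w).length_hist n ω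
  rw [h0, List.length_nil] at this
  omega

/-- **Completeness of the exploration** (Kozma–Nachmias 2011, §4.4): once it has stopped, every
vertex of `Q_j` joined to the origin inside `Q_j` lies in the explored region — otherwise the first
vertex of an open path from `0` outside the explored region would make its (unexplored, boundary)
box active. Requires the origin to lie in the interior region (`j > 4S`).
[cite: KozmaNachmias2011, §4.4 (the exploration of C(0; Q_j), pp. 393–394)] -/
theorem mem_explored_of_openConnIn (h0 : (0 : Site d) ∈ interior j S w) {ω : BondConfig (Site d)} {n : ℕ} (hn : 1 ≤ n)
    (hstop : (knExplorer j S w).next ((knExplorer j S w).hist n ω) = none) {y : Site d}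
    (hy : ω ∈ openConnIn (↑(box d j) : Set (Site d)) (0 : Site d) y) :
    y ∈ explored j ((knExplorer j S w).hist n ω) := by
  set h := (knExplorer j S w).hist n ω with hh
  have hI := histInv_hist (j := j) (S := S) (w := w) (Bad := fun _ => (Set.univ : Set (BondConfig (Site d))))
    (fun v _ => determinedBy_univ _) ω n
  have hne : h ≠ [] := hist_ne_nil ω hn
  obtain ⟨-, hexpl⟩ : h ≠ [] ∧ explored j h = interior j S w ∪ (exploredPts j S w h).biUnion (qbox j S) := by
    rcases hI.expl with ⟨h0', -⟩ | h' ; · exact absurd h0' hne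
    exact h'
  set R := explored j h with hR
  have hRj : R ⊆ box d j := explored_subset_box j h
  have h0R : (0 : Site d) ∈ R := by rw [hexpl]; exact Finset.mem_union_left _ h0
  by_contra hyR
  obtain ⟨a, b, haR, hbR, hbj, hab, hpa⟩ := (mem_openConnIn_iff_pathIn.1 hy).exit (R := (↑R : Set (Site d)))
    (Finset.mem_coe.2 h0R) (fun h' => hyR (Finset.mem_coe.1 h'))
  have haR' : a ∈ R := Finset.mem_coe.1 haR
  have hbR' : b ∉ R := fun h' => hbR (Finset.mem_coe.2 h')
  have hbj' : b ∈ box d j := Finset.mem_coe.1 hbj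
  have hadj := (openGraph_adj ω a b).1 hab
  -- open pairs of `ω` inside `R` are revealed open pairs
  have hrev : ∀ a' b' : Site d, a' ∈ R → b' ∈ box d j → s(a', b') ∈ ω → s(a', b') ∈ openObs h := by
    intro a' b' ha' hb' he
    refine (hI.obs _).2 ⟨he, ?_⟩
    rw [hI.supp_eq]
    exact mk_mem_pairsTouching.2 ⟨⟨hRj ha', hb'⟩, Or.inl ha'⟩
  -- `a` lies in the revealed cluster of the origin
  have haK : a ∈ known j h := by
    refine Finset.mem_filter.2 ⟨haR', mem_openConnIn_iff_pathIn.2 ?_⟩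
    have hpa' : PathIn (openGraph ω) (↑R : Set (Site d)) 0 a := hpa.mono Set.inter_subset_left
    refine pathIn_congrGraph (fun u v hu hv huv => ?_) hpa'
    rw [openGraph_adj] at huv ⊢
    exact ⟨Finset.mem_coe.2 (hrev u v (Finset.mem_coe.1 hu) (hRj (Finset.mem_coe.1 hv)) huv.1), huv.2⟩
  -- the box of `b` is active
  set v' := gridOf S w b with hv'
  have hbq : b ∈ qbox j S v' := mem_qbox_gridOf S w hbj'
  have hv'G : v' ∈ gridPts j S w := gridOf_mem_gridPts S w hbj'
  have hbdry : IsBoundaryPt j S v' := by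
    by_contra hnb
    exact hbR' (by rw [hexpl]; exact Finset.mem_union_left _ (mem_interior.2 ⟨hbj', hnb⟩))
  have hqR : ∀ u ∈ qbox j S v', u ∉ R := by
    intro u hu huR
    rw [hexpl, Finset.mem_union, Finset.mem_biUnion] at huR
    rcases huR with hui | ⟨v'', hv'', huv''⟩
    · exact Finset.disjoint_left.1 (disjoint_qbox_interior (isGridPt_gridOf S w b) hbdry) hu hui
    · have heq := eq_of_mem_qbox_of_mem_qbox (isGridPt_gridOf S w b) (mem_gridPts.1 (mem_exploredPts.1 hv'').1).2.1 hu huv''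
      refine hbR' ?_
      rw [hexpl, Finset.mem_union, Finset.mem_biUnion]
      exact Or.inr ⟨v'', hv'', heq ▸ hbq⟩
  have hact : IsActive j S w h v' := by
    refine ⟨hv'G, hbdry, Finset.disjoint_left.2 hqR, ?_, b, hbq, a, haK, hrev a b haR' hbj' hadj.1, hadj.2⟩
    refine Finset.disjoint_left.2 fun e he hes => ?_
    rw [hI.supp_eq] at hes
    revert he hes
    induction e using Sym2.ind with
    | h c₁ c₂ =>
      intro he hes
      obtain ⟨hc₁, hc₂⟩ := Finset.mk_mem_sym2_iff.1 he
      rcases (mk_mem_pairsTouching.1 hes).2 with hc | hc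
      · exact hqR c₁ hc₁ hc
      · exact hqR c₂ hc₂ hc
  have : (knExplorer j S w).next h = some _ := knNext_of_active hne ⟨v', hact⟩
  rw [hstop] at this
  cases this

/-- **Hits are boundary vertices joined to the origin**: `X_j ≥ #{hits}` along every genuine
history ("`X_j ≥ |{k ≤ i : ∃ x ∈ q_k ∩ ∂Q_j : 0 ↔ x}|`", proof of Lemma 4.5).
[cite: KozmaNachmias2011, proof of Lemma 4.5 (p. 394)] -/
theorem nfail_hit_le_boundaryConnCount (ω : BondConfig (Site d)) (n : ℕ) :
    nfail (fun h o => ¬hitPred j S w h o) knDesig ((knExplorer j S w).hist n ω) ≤ boundaryConnCount d j ω := by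
  classical
  have hI := histInv_hist (j := j) (S := S) (w := w) (Bad := fun _ => (Set.univ : Set (BondConfig (Site d))))
    (fun v _ => determinedBy_univ _) ω n
  obtain ⟨Xs, hXs, hcard, -⟩ := hI.hit
  rw [← hcard]
  unfold boundaryConnCount
  convert Finset.card_le_card hXs using 2

/-- The bad event of a box built from a family of vertex marks: some marked vertex of `∂Q_j` in the
box. [cite: KozmaNachmias2011, §4.4 ("a box q ∈ G is s-bad if there exists some x ∈ ∂Q_j which is s-locally-bad and such that (x + Q_{s^{4d²}}) ∩ Q_j ⊂ q")] -/
def markedBad (j S : ℕ) (Mark : Site d → Set (BondConfig (Site d))) (v : Site d) : Set (BondConfig (Site d)) :=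
  {ω | ∃ x ∈ qbox j S v, x ∈ sphere d j ∧ ω ∈ Mark x}

/-- If the marks of the vertices of a box are determined by the pairs of the box, so is its bad
event. [folklore] -/
theorem determinedBy_markedBad {Mark : Site d → Set (BondConfig (Site d))} {v : Site d}
    (hMark : ∀ x ∈ qbox j S v, DeterminedBy (Mark x) ↑(qbox j S v).sym2) :
    DeterminedBy (markedBad j S Mark v) ↑(qbox j S v).sym2 := by
  rw [determinedBy_iff]
  intro ω ω' hωω'
  simp only [markedBad, Set.mem_setOf_eq]
  refine exists_congr fun x => and_congr_right fun hx => and_congr_right fun _ => ?_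
  exact (determinedBy_iff _ _).1 (hMark x hx) ω ω' hωω'

/-- **Marked boundary vertices joined to the origin are few unless many explored boxes are bad**
(Kozma–Nachmias 2011, proof of Lemma 4.6: "`X_j^{s-loc-bad}(w) ≤ s^{d-1} |{k ≤ τ : q_k is bad}|`",
here with `|q| ≤ (4S+1)^d` for `s^{d-1}`): once the exploration has stopped, every marked `x ∈ ∂Q_j`
with `0 ↔ x` in `Q_j` lies in an explored boundary box, which is then bad.
[cite: KozmaNachmias2011, proof of Lemma 4.6 (p. 396)] -/
theorem card_marked_le (h0 : (0 : Site d) ∈ interior j S w) {Mark : Site d → Set (BondConfig (Site d))}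
    (hMark : ∀ v ∈ gridPts j S w, ∀ x ∈ qbox j S v, DeterminedBy (Mark x) ↑(qbox j S v).sym2)
    {ω : BondConfig (Site d)} {n : ℕ} (hn : 1 ≤ n) (hstop : (knExplorer j S w).next ((knExplorer j S w).hist n ω) = none) :
    #((sphere d j).filter fun x => ω ∈ openConnIn (↑(box d j) : Set (Site d)) (0 : Site d) x ∧ ω ∈ Mark x) ≤
      (4 * S + 1) ^ d * nfail (fun h o => ¬badPred j S w (markedBad j S Mark) h o) knDesig ((knExplorer j S w).hist n ω) := by
  classical
  set h := (knExplorer j S w).hist n ω with hh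
  have hdet : ∀ v ∈ gridPts j S w, DeterminedBy (markedBad j S Mark v) ↑(qbox j S v).sym2 :=
    fun v hv => determinedBy_markedBad (hMark v hv)
  have hI := histInv_hist hdet ω n
  have hne : h ≠ [] := hist_ne_nil ω hn
  obtain ⟨-, hexpl⟩ : h ≠ [] ∧ explored j h = interior j S w ∪ (exploredPts j S w h).biUnion (qbox j S) := by
    rcases hI.expl with ⟨h0', -⟩ | h' ; · exact absurd h0' hne
    exact h'
  set EPB := (exploredPts j S w h).filter fun v => ω ∈ markedBad j S Mark v with hEPB
  have hsub : ((sphere d j).filter fun x => ω ∈ openConnIn (↑(box d j) : Set (Site d)) (0 : Site d) x ∧ ω ∈ Mark x) ⊆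
      EPB.biUnion (qbox j S) := by
    intro x hx
    obtain ⟨hxs, hconn, hmark⟩ := Finset.mem_filter.1 hx
    have hxR := mem_explored_of_openConnIn h0 hn hstop hconn
    rw [hexpl, Finset.mem_union, Finset.mem_biUnion] at hxR
    rcases hxR with hxi | ⟨v, hv, hxv⟩
    · exact absurd hxi (not_mem_interior_of_mem_sphere hxs)
    · exact Finset.mem_biUnion.2 ⟨v, Finset.mem_filter.2 ⟨hv, x, hxv, hxs, hmark⟩, hxv⟩
  calc #((sphere d j).filter fun x => ω ∈ openConnIn (↑(box d j) : Set (Site d)) (0 : Site d) x ∧ ω ∈ Mark x)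
      ≤ #(EPB.biUnion (qbox j S)) := Finset.card_le_card hsub
    _ ≤ ∑ v ∈ EPB, #(qbox j S v) := Finset.card_biUnion_le
    _ ≤ ∑ _v ∈ EPB, (4 * S + 1) ^ d := Finset.sum_le_sum fun v _ => card_qbox_le j S v
    _ = (4 * S + 1) ^ d * #EPB := by rw [Finset.sum_const, smul_eq_mul, mul_comm]
    _ = _ := by rw [hI.bad]

end Consequences

end Literature.Barriers.CriticalPhenomena

end
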